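import Literature.NumberTheory.EllipticCurves.HeegnerStabilizedClassOfCoherentPairProofs
import Literature.NumberTheory.EllipticCurves.FixedGeomPointsFiniteProofs
import Literature.NumberTheory.EllipticCurves.AnticyclotomicCharacterLayerProofs
import Literature.NumberTheory.EllipticCurves.CornutVatsal2007.CMPointsNontriviality
import HarnessLib

/-!
# The `Λ`-adic stabilised Heegner class `κ_∞` of the coherent CGLS datum is NON-ZERO, granted
# Cornut–Vatsal 2007 Thm. 1.10: `Λκ_∞(C) = Λ ∙ κ_∞ ≠ ⊥` (CGLS 2022 Rem. 4.1.4 «κ₁^{Hg} ≠ 0 by Cornut–Vatsal»; proofs file)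

Topic `NumberTheory/EllipticCurves`. THEOREMS ONLY (no definition, no named fact, no `sorry`, no instance).
Written by the cell `bsd-print-x9`, seat `bsd-line-x9-p1-w2` (g14), for the write-crux stmt-BirchSwinnertonDyer-25235
(`PrintX9.HowardContainmentLightFrameOfPrint`). The row-9/row-10 closers consume the cite-only binder
`PrintX9.CGLSHeegnerClassNonvanishing` (stmt-27103; CGLS 2022 Thm. 4.1.1 + Rem. 4.1.4 + §3.3) ONLY at the envelope
engine's coherent datum `C₀` (`exists_coherent_pair_envelope`) and ONLY through its conjunct
«`𝔖 ⧸ Λκ_∞(C₀)` is `Λ`-torsion», which at `Λ`-rank one (CGLS Thm. 4.1.3 / CGS Thm. 6.5.2) and torsion-freeness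
(kernel theorem p645741) is «`Λκ_∞(C₀) ≠ ⊥`». The tree already has the CLASS `κ_∞ ∈ 𝔖` with `proj_k κ_∞ = δ(κ_k)`
(`k > δ`) and `Λκ_∞(C₀) = Λ ∙ κ_∞` (`exists_coherent_pair_envelope_principal_class`, x9-p2 g2). THIS FILE proves
`κ_∞ ≠ 0` from the tree's statement-only Cornut–Vatsal leaf `CornutVatsal2007.thm110_exists_heegnerCharSum_ne_zero`
(Thm. 1.10 for the newform of `E/ℚ`), i.e. it replaces the composite binder 27103 by ONE primitive printed theorem in
the untied closers.

THE ARGUMENT (`k = j + 1`, `j > δ` large, `τ = γ^{p^j}`, `H = Gal(K̄/K_{j+1})`, `α` the unit root).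
If `κ_∞ = 0` then `δ(κ_{j+1}) = α^{-d}(δ_H(u) − α⁻¹ δ_H(v)) = 0` (`u = u_{j+1}`, `v = v_{j+1}`), so `δ_H(u) = α⁻¹·δ_H(v)`.
The engine's identity (P1″) says `v` is `K_j`-rational, so `conj_τ δ_H(v) = δ_H(τ v) = δ_H(v)`, whence
`δ_H(τ u) = conj_τ δ_H(u) = δ_H(u)` and the Kummer family of `τ u − u ∈ E(K_{j+1})` vanishes: `τ u − u` is
divisible by every `p^m` in `E(K_{j+1})`, hence TORSION (Mordell–Weil at the layer, `FixedGeomPointsFiniteProofs`).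
Then for every character `φ` of `Γ_K` killing `H` with `φ(τ) ≠ 1` the sum `S = Σ_{i<p^{j+1}} φ(γ^i) ⊗ γ^i u` in
`ℂ ⊗_ℤ E(K̄)` vanishes: replacing `u` by `τ u = u + (torsion)` does not change `S` but multiplies it by `φ(τ)⁻¹`
(shift `i ↦ i + p^j` of a `p^{j+1}`-periodic summand). But Cornut–Vatsal Thm. 1.10 (`χ₀ = 1`) at the Heegner point
`x = P[p^{d(j+1)}]` supplies such a `φ` (finite order anticyclotomic, trivial on `Gal(K̄/K[p^{d(j+1)}])` — hence on `H`,
since `K_{j+1} ⊆ K[p^{d(j+1)}]`, `K_{j+2} ⊄ K[p^{d(j+1)}]` — and non-trivial on `Gal(K̄/K[p^{d(j+1)−1}]) ≤ Gal(K̄/K_j)`,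
hence at `τ`) with `Σ_{r ∈ R} φ(r) ⊗ r x ≠ 0` for ANY transversal `R` of `Gal(K̄/K[p^{d(j+1)}])` in `Γ_K`; for the product
transversal `R = {γ^i}_{i<p^{j+1}} · A_{j+1}` this sum IS `S` (`u = Σ_{a ∈ A_{j+1}} a x`). Contradiction.

WHAT.
* §1 `isOfFinAddOrder_smul_sub_of_isKummerFamilyOver_eq_padicPi` (Kummer step + Mordell–Weil at the layer).
* §2 `sum_range_tmul_smul_eq_zero_of_isOfFinAddOrder` (the character-sum step, pure algebra in `ℂ ⊗_ℤ M`; private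
  helpers: torsion dies in `ℂ ⊗_ℤ M`, shift-invariance of periodic sums),
  `heegnerCharSum_image_mul_eq` (character sums over product transversals).
* §3 **`exists_coherent_pair_envelope_class_ne_zero_of_thm110`**: the engine's `∃ C F κ_∞` on `(Dt, β)` with the
  envelope, `proj_k κ_∞ = δ(κ_k)`, `Λκ_∞(C) = Λ ∙ κ_∞` AND `κ_∞ ≠ 0`; **`exists_coherent_pair_envelope_ne_bot_of_thm110`**:
  the L∃-shaped `∃ C F` with the envelope and `stabilizedHeegnerModule D C ≠ ⊥`.
HONEST FRAMING: CONDITIONAL on the named fact `CornutVatsal2007.thm110_exists_heegnerCharSum_ne_zero` (Cornut–Vatsal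
2007 Thm. 1.10, statement-only in the tree), taken as a hypothesis `hCV`; everything else is kernel. Nothing about any
particular curve; «beyond-print theorem»: no (the content is CGLS Rem. 4.1.4's one-line appeal to Cornut–Vatsal, typed);
BSD is not proved by any of this.

References: [CornutVatsal2007] Thm. 1.10 and §1.5 ¶1 (non-triviality of Howard's Euler system);
[CastellaGrossiLeeSkinner2022] Thm. 4.1.1 proof and Rem. 4.1.4 (arXiv:2008.02571v2 TeX L2213–2294);
[Howard2004HeegnerKolyvagin] §3.3, Thm. 3.3.7 (proof: "by the main result of [Cornut], one of the points has infinite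
order"); [PerrinRiou1987BSMF] §3.3–3.4; [SilvermanAEC2009] Thm. VIII.6.7.
-/

set_option autoImplicit false

noncomputable section

open scoped Classical Pointwise TensorProduct

open WeierstrassCurve Literature.NumberTheory.EllipticCurves
  Literature.NumberTheory.EllipticCurves.CastellaGrossiLeeSkinner2022 ModularForms RingClassField PowerSeries

namespace Literature.NumberTheory.EllipticCurves

/-! ## §1 The Kummer step: `δ_H(u) = c · δ_H(v)` with `τ v = v` forces `τ u − u` torsion -/

section KummerStep

variable {K : Type} [Field K] [NumberField K] (V : WeierstrassCurve K) [V.IsElliptic] {p : ℕ} [Fact p.Prime]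
  (κ : ZpExtension K p)

/-- **The Kummer step.** Over `H = Gal(K̄/K_n)`: if the Kummer family of an `H`-fixed `u` is a `ℤ_p`-multiple `c · δ_H(v)`
of that of an `H`-fixed `v` with `τ v = v`, then `δ_H(τ u − u) = conj_τ δ_H(u) − δ_H(u) = c · (conj_τ δ_H(v) − δ_H(v)) = 0`,
so `τ u − u ∈ ⋂_m p^m E(K_n)` is a torsion point (Mordell–Weil at the layer `K_n`).
[cite: Howard2004HeegnerKolyvagin, §1 (the compact Kummer map E(L) ⊗ ℤ_p ↪ S_p(E/L) is Gal-equivariant)]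
[cite: SilvermanAEC2009, Thm. VIII.6.7] -/
theorem isOfFinAddOrder_smul_sub_of_isKummerFamilyOver_eq_padicPi (n : ℕ) (τ : Field.absoluteGaloisGroup K)
    {u v : geomPoints V} (hu : ∀ σ ∈ κ.layerSubgroup n, σ • u = u) (hv : ∀ σ ∈ κ.layerSubgroup n, σ • v = v)
    (hτv : τ • v = v) {du dv : V.torsionH1Pi p (κ.layerSubgroup n)}
    (hdu : V.IsKummerFamilyOver p (κ.layerSubgroup n) hu du) (hdv : V.IsKummerFamilyOver p (κ.layerSubgroup n) hv dv)
    {c : ℤ_[p]} (h : du = V.padicPi p (κ.layerSubgroup n) c dv) :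
    IsOfFinAddOrder (τ • u - u) := by
  have hp : p.Prime := Fact.out
  have hconj : ∀ {σ : Field.absoluteGaloisGroup K}, σ ∈ κ.layerSubgroup n → τ⁻¹ * σ * τ ∈ κ.layerSubgroup n :=
    fun {σ} hσ ↦ by
      have := (κ.layerSubgroup_normal n).conj_mem σ hσ τ⁻¹
      rwa [inv_inv] at this
  -- `conj_τ δ(v) = δ(τ v) = δ(v)`
  have hcv : V.IsKummerFamilyOver p (κ.layerSubgroup n) (P := τ • v) _ (V.conjPi p (κ.layerSubgroup n) τ dv) :=
    hdv.conjPi τ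
  have hcv' : V.IsKummerFamilyOver p (κ.layerSubgroup n) hv (V.conjPi p (κ.layerSubgroup n) τ dv) :=
    IsKummerFamilyOver.of_eq hτv hcv
  have hdv_eq : V.conjPi p (κ.layerSubgroup n) τ dv = dv := IsKummerFamilyOver.unique p hcv' hdv
  -- `conj_τ δ(u) = δ(u)`
  have hdu_eq : V.conjPi p (κ.layerSubgroup n) τ du = du := by rw [h, conjPi_padicPi_comm, hdv_eq]
  -- `δ(τ u) = conj_τ δ(u) = δ(u)`, so `δ(τ u − u) = 0`
  have hcu : V.IsKummerFamilyOver p (κ.layerSubgroup n) (P := τ • u) _ (V.conjPi p (κ.layerSubgroup n) τ du) :=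
    hdu.conjPi τ
  rw [hdu_eq] at hcu
  have hτu : ∀ σ ∈ κ.layerSubgroup n, σ • (τ • u) = τ • u := fun σ hσ ↦ by
    rw [← mul_smul, show σ * τ = τ * (τ⁻¹ * σ * τ) by group, mul_smul, hu _ (hconj hσ)]
  have hdiff : V.IsKummerFamilyOver p (κ.layerSubgroup n) (P := τ • u - u)
      (fun σ hσ ↦ by rw [smul_sub, hτu σ hσ, hu σ hσ]) (du + -du) :=
    IsKummerFamilyOver.of_eq (sub_eq_add_neg (τ • u) u).symm (IsKummerFamilyOver.add p hcu hdu.neg)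
  rw [add_neg_cancel] at hdiff
  have hQ : τ • u - u ∈ V.fixedGeomPoints (κ.layerSubgroup n) :=
    (V.mem_fixedGeomPoints_iff _).2 fun σ hσ ↦ by rw [smul_sub, hτu σ hσ, hu σ hσ]
  have hfam : V.kummerFamily p (κ.layerSubgroup n) ⟨τ • u - u, hQ⟩ = 0 :=
    (IsKummerFamilyOver.eq_kummerFamily p _ hdiff).symm
  -- divisibility by every `p^m` inside `E(K_n)`, then Mordell–Weil at the layer `K_n`
  haveI : FiniteDimensional K (κ.layer n) := κ.finiteDimensional_layer_holds n
  refine isOfFinAddOrder_of_mem_fixedGeomPoints_of_forall_exists_pow_smul_eq V (κ.layerSubgroup n) (κ.layer n)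
    le_rfl hp hQ fun m ↦ ?_
  obtain ⟨R, hR⟩ := (V.kummerFamily_apply_eq_zero_iff p (κ.layerSubgroup n) ⟨τ • u - u, hQ⟩ m).mp
    (by rw [hfam]; rfl)
  exact ⟨R, R.2, by simpa only [AddSubgroupClass.coe_zsmul] using congrArg Subtype.val hR⟩

end KummerStep

/-! ## §2 The character-sum step (algebra in `ℂ ⊗_ℤ M`) -/

section CharSumStep

variable {Γ : Type*} [Group Γ] {M : Type*} [AddCommGroup M] [DistribMulAction Γ M]

/-- In `ℂ ⊗_ℤ M` every `c ⊗ t` with `t` of finite order vanishes (`ℂ` is divisible). [folklore] -/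
private theorem tmul_eq_zero_of_isOfFinAddOrder' (c : ℂ) {t : M} (ht : IsOfFinAddOrder t) :
    c ⊗ₜ[ℤ] t = (0 : ℂ ⊗[ℤ] M) := by
  obtain ⟨n, hn, hnt⟩ := ht.exists_nsmul_eq_zero
  have hc : c = (n : ℤ) • (c / n) := by
    rw [zsmul_eq_mul, Int.cast_natCast, mul_div_cancel₀ _ (Nat.cast_ne_zero.mpr hn.ne')]
  rw [hc, TensorProduct.smul_tmul, natCast_zsmul, hnt, TensorProduct.tmul_zero]

/-- A shift does not change the sum over a period of a periodic sequence (additive group). [folklore] -/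
private theorem sum_range_add_eq_of_periodic {A : Type*} [AddCommGroup A] {f : ℕ → A} {n : ℕ}
    (hf : ∀ i, f (i + n) = f i) (c : ℕ) :
    ∑ i ∈ Finset.range n, f (i + c) = ∑ i ∈ Finset.range n, f i := by
  -- one step, for any periodic `g`
  have step : ∀ g : ℕ → A, (∀ i, g (i + n) = g i) →
      ∑ i ∈ Finset.range n, g (i + 1) = ∑ i ∈ Finset.range n, g i := by
    intro g hg
    have h1 := Finset.sum_range_succ' g n
    have h2 := Finset.sum_range_succ g n
    have h0 : g n = g 0 := by simpa only [zero_add] using hg 0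
    rw [h0] at h2
    exact add_right_cancel (h1.symm.trans h2)
  induction c with
  | zero => simp only [add_zero]
  | succ c ih =>
    calc ∑ i ∈ Finset.range n, f (i + (c + 1))
        = ∑ i ∈ Finset.range n, (fun i ↦ f (i + c)) (i + 1) :=
          Finset.sum_congr rfl fun i _ ↦ by rw [show i + (c + 1) = i + 1 + c by omega]
      _ = ∑ i ∈ Finset.range n, f (i + c) := step (fun i ↦ f (i + c)) fun i ↦ by
          show f (i + n + c) = f (i + c)
          rw [show i + n + c = i + c + n by omega, hf]
      _ = _ := ih

/-- **The character-sum step.** In `ℂ ⊗_ℤ M`: if `γ^n u = u`, `φ(γ^n) = 1`, `γ^m u − u` has finite order and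
`φ(γ^m) ≠ 1`, then `Σ_{i<n} φ(γ^i) ⊗ γ^i u = 0` (replacing `u` by `γ^m u` leaves the sum unchanged — torsion dies in
`ℂ ⊗ M` — and multiplies it by `φ(γ^m)⁻¹`, by the shift `i ↦ i + m` of the `n`-periodic summand).
[cite: CornutVatsal2007, §1.5 ¶1 (a(x, χ) ≠ 0 forces non-torsion components)] -/
theorem sum_range_tmul_smul_eq_zero_of_isOfFinAddOrder (φ : Γ →* ℂˣ) (γ : Γ) {n m : ℕ} (u : M)
    (hper_u : γ ^ n • u = u) (hper_φ : φ (γ ^ n) = 1) (htor : IsOfFinAddOrder (γ ^ m • u - u))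
    (hne : φ (γ ^ m) ≠ 1) :
    ∑ i ∈ Finset.range n, ((φ (γ ^ i) : ℂˣ) : ℂ) ⊗ₜ[ℤ] (γ ^ i • u) = 0 := by
  set f : ℕ → ℂ ⊗[ℤ] M := fun i ↦ ((φ (γ ^ i) : ℂˣ) : ℂ) ⊗ₜ[ℤ] (γ ^ i • u) with hf
  set S := ∑ i ∈ Finset.range n, f i with hS
  have hfper : ∀ i, f (i + n) = f i := fun i ↦ by
    simp only [hf, pow_add, map_mul, mul_smul, hper_u, hper_φ, mul_one]
  -- (a) replacing `u` by `γ^m u` does not change the sum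
  have ha : ∑ i ∈ Finset.range n, ((φ (γ ^ i) : ℂˣ) : ℂ) ⊗ₜ[ℤ] (γ ^ i • (γ ^ m • u)) = S := by
    refine Finset.sum_congr rfl fun i _ ↦ ?_
    have hsplit : γ ^ m • u = u + (γ ^ m • u - u) := by abel
    have htor' : IsOfFinAddOrder (γ ^ i • (γ ^ m • u - u)) := by
      obtain ⟨N, hN, hNt⟩ := htor.exists_nsmul_eq_zero
      exact isOfFinAddOrder_iff_nsmul_eq_zero.mpr ⟨N, hN, by rw [smul_comm, hNt, smul_zero]⟩
    rw [hsplit, smul_add, TensorProduct.tmul_add, tmul_eq_zero_of_isOfFinAddOrder' _ htor', add_zero]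
  -- (b) … and multiplies it by `φ(γ^m)⁻¹`
  have hb : ∑ i ∈ Finset.range n, ((φ (γ ^ i) : ℂˣ) : ℂ) ⊗ₜ[ℤ] (γ ^ i • (γ ^ m • u)) =
      ((φ (γ ^ m))⁻¹ : ℂˣ).val • ∑ i ∈ Finset.range n, f (i + m) := by
    rw [Finset.smul_sum]
    refine Finset.sum_congr rfl fun i _ ↦ ?_
    have hcoef : ((φ (γ ^ i) : ℂˣ) : ℂ) = ((φ (γ ^ m))⁻¹ : ℂˣ).val * ((φ (γ ^ (i + m)) : ℂˣ) : ℂ) := by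
      rw [pow_add, map_mul, Units.val_mul, ← mul_assoc, mul_comm (((φ (γ ^ m))⁻¹ : ℂˣ).val),
        mul_assoc, Units.inv_mul, mul_one]
    simp only [hf]
    rw [← mul_smul, ← pow_add, hcoef, TensorProduct.smul_tmul', smul_eq_mul]
  -- (c) the shifted sum is the sum
  rw [sum_range_add_eq_of_periodic hfper m, ← hS] at hb
  have hSS : S = ((φ (γ ^ m))⁻¹ : ℂˣ).val • S := ha.symm.trans hb
  have hc1 : (1 : ℂ) - ((φ (γ ^ m))⁻¹ : ℂˣ).val ≠ 0 := by
    intro h0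
    apply hne
    have h1 : ((φ (γ ^ m))⁻¹ : ℂˣ).val = 1 := (sub_eq_zero.mp h0).symm
    have h2 : (φ (γ ^ m))⁻¹ = 1 := Units.val_eq_one.mp h1
    exact inv_eq_one.mp h2
  have hzero : ((1 : ℂ) - ((φ (γ ^ m))⁻¹ : ℂˣ).val) • S = 0 := by rw [sub_smul, one_smul, ← hSS, sub_self]
  calc S = ((1 : ℂ) - ((φ (γ ^ m))⁻¹ : ℂˣ).val)⁻¹ • (((1 : ℂ) - ((φ (γ ^ m))⁻¹ : ℂˣ).val) • S) :=
        (inv_smul_smul₀ hc1 S).symm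
    _ = 0 := by rw [hzero, smul_zero]

/-- **Character sums over a product transversal**: for `R = S·A` (image of `S × A` under multiplication, injective)
and a character trivial on `A`, `Σ_{r ∈ R} φ(r) ⊗ r x = Σ_{s ∈ S} φ(s) ⊗ s (Σ_{a ∈ A} a x)`.
[cite: CornutVatsal2007, §1.3 (a(x, χ) as a sum over G(n))] [cite: Howard2004HeegnerKolyvagin, §3.3 (iterated norms)] -/
theorem heegnerCharSum_image_mul_eq {K : Type} [Field K] {V : WeierstrassCurve K}
    (φ : Field.absoluteGaloisGroup K →* ℂˣ) {S A : Finset (Field.absoluteGaloisGroup K)}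
    (hinj : Set.InjOn (fun q : Field.absoluteGaloisGroup K × Field.absoluteGaloisGroup K ↦ q.1 * q.2) ↑(S ×ˢ A))
    (hφA : ∀ a ∈ A, φ a = 1) (x : geomPoints V) :
    CornutVatsal2007.heegnerCharSum φ ((S ×ˢ A).image fun q ↦ q.1 * q.2) x =
      ∑ s ∈ S, ((φ s : ℂˣ) : ℂ) ⊗ₜ[ℤ] (s • ∑ a ∈ A, a • x) := by
  rw [CornutVatsal2007.heegnerCharSum_def, Finset.sum_image hinj, Finset.sum_product]
  refine Finset.sum_congr rfl fun s _ ↦ ?_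
  rw [Finset.smul_sum, TensorProduct.tmul_sum]
  refine Finset.sum_congr rfl fun a ha ↦ ?_
  rw [map_mul, hφA a ha, mul_one, mul_smul]

end CharSumStep

/-! ## §3 The engine's coherent pair with a NON-ZERO `Λ`-adic stabilised class -/

section Envelope

variable {K : Type} [Field K] [NumberField K] {W : WeierstrassCurve ℚ} [W.IsElliptic] [W.IsGloballyMinimal]
  [NeZero (W.conductorNorm ℤ)] {p : ℕ} [Fact p.Prime]

/-- **The coherent pair with its principal system, its `Λ`-adic stabilised class, AND `κ_∞ ≠ 0` — granted
Cornut–Vatsal 2007 Thm. 1.10.** Same hypotheses and same construction as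
`exists_coherent_pair_envelope_principal_class` plus `κ` anticyclotomic (needed by the Cornut–Vatsal leaf); the `∃`
additionally returns `z ≠ 0` (module docstring for the argument).
[cite: CornutVatsal2007, Thm. 1.10 and §1.5 ¶1] [cite: CastellaGrossiLeeSkinner2022, Thm. 4.1.1 proof and Rem. 4.1.4 (κ₁^{Hg} ≠ 0 by Cornut–Vatsal)]
[cite: Howard2004HeegnerKolyvagin, §3.3 and Thm. 3.3.7 (proof)] -/
theorem exists_coherent_pair_envelope_class_ne_zero_of_thm110
    (hCV : CornutVatsal2007.thm110_exists_heegnerCharSum_ne_zero) (hK : IsImaginaryQuadratic K)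
    (hH : SatisfiesHeegnerHypothesis (W.conductorNorm ℤ) K) (Dt : ModularParametrizationData W (W.conductorNorm ℤ))
    {β : ℤ} (hβ : (4 * (W.conductorNorm ℤ : ℕ) : ℤ) ∣ β ^ 2 - NumberField.discr K)
    (jbar : AlgebraicClosure K →+* ℂ) (hord : IsOrdinaryAt W p) (hpN : ¬ p ∣ W.conductorNorm ℤ)
    (κ : ZpExtension K p) (hκ : κ.IsAnticyclotomic) {γ : Field.absoluteGaloisGroup K} (hγ : κ.IsTopGenerator γ)
    (hTw1 : ∀ k, ringClassSubgroup K (p ^ (k + 1)) jbar ≤ κ.layerSubgroup k)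
    (hcardp : Nat.card (ringClassGalOver (jbar.comp (algebraMap K (AlgebraicClosure K))) p 1) = p - 1)
    (hE : ∀ Q : (W.baseChange K).toAffine.Point, p • Q = 0 → Q = 0)
    (D : (W.baseChange K).LambdaAdicSelmerData κ γ) :
    ∃ (C : StabilizedHeegnerData (W.conductorNorm ℤ) W K κ jbar) (F : HeegnerFamily (W.conductorNorm ℤ) W K κ jbar),
      C.Dt = Dt ∧ F.Dt = Dt ∧ C.β = β ∧ F.β = β ∧
      heegnerModule D F ≤ stabilizedHeegnerModule D C ∧
      (∃ g : IwasawaAlgebra p, g ≠ 0 ∧ g • stabilizedHeegnerModule D C ≤ heegnerModule D F) ∧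
      ∃ z : D.S, (∀ (k : ℕ) (hk : C.depth < k), D.proj k z ∈ stabilizedClassLayer C k hk) ∧
        stabilizedHeegnerModule D C = Submodule.span (IwasawaAlgebra p) {z} ∧ z ≠ 0 := by
  have hp : p.Prime := Fact.out
  have hap : ¬ (p : ℤ) ∣ W.frobeniusTrace p := hord.2
  have hunit : IsUnit (unitRoot W p) := (unitRoot_spec_holds W p hord).2
  -- the principal system and the two coherent structures on it (as in the engine)
  obtain ⟨x, P, hxP⟩ := exists_principalSystem hK hH Dt hβ jbar hp hpN
  have hx : ∀ j, complexPoint W jbar (x j) = heegnerPointComplexOfConductor Dt (NumberField.discr K) β (p ^ j) :=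
    fun j ↦ (hxP j).1
  have hP : ∀ j, WeierstrassCurve.Affine.Point.map (W' := W)
      (ringClassField K (jbar.comp (algebraMap K (AlgebraicClosure K))) (p ^ j)).subtype.toRatAlgHom (P j) =
      heegnerPointComplexOfConductor Dt (NumberField.discr K) β (p ^ j) := fun j ↦ (hxP j).2.1
  have hgeom : ∀ j, IsHeegnerGeomPoint (W.conductorNorm ℤ) W K Dt β (p ^ j) jbar (x j) := fun j ↦ (hxP j).2.2.1
  have hfix : ∀ j, ∀ σ ∈ ringClassSubgroup K (p ^ j) jbar, σ • x j = x j := fun j ↦ (hxP j).2.2.2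
  obtain ⟨F, T, R, hFDt, hFβ, -, -, hR, hz⟩ := exists_heegnerFamily_of_system Dt hβ jbar κ hgeom hfix
  obtain ⟨C, Aₜ, hCDt, hCβ, hdle, htwo, hA, hu, hv⟩ :=
    exists_stabilizedHeegnerData_of_system hK Dt hβ jbar κ hTw1 hcardp hgeom hfix
  obtain ⟨A, hA0, hA1, hArec⟩ := exists_int_lucas_seq (W.frobeniusTrace p) p 1 (W.frobeniusTrace p)
  obtain ⟨B, hB0, hB1, hBrec⟩ := exists_int_lucas_seq (W.frobeniusTrace p) p 0 (-1)
  have hd1 : ∀ j, C.depth ≤ j → 2 ≤ C.d (j + 1) := fun j hj ↦ htwo (j + 1) (by omega)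
  have hnot : ∀ j, C.depth ≤ j → ¬ ringClassSubgroup K (p ^ (C.d (j + 1) - 1)) jbar ≤ κ.layerSubgroup (j + 1) :=
    fun j hj ↦ C.d_min (j + 1) _ (by have := hd1 j hj; omega)
  have hd0 : ∀ j, C.depth < j → 1 ≤ C.d j := fun j hj ↦ le_trans one_le_two (htwo j hj)
  have hpredle : ∀ j, C.depth ≤ j → ringClassSubgroup K (p ^ (C.d (j + 1) - 1)) jbar ≤ κ.layerSubgroup j :=
    fun j hj ↦ ringClassSubgroup_pred_le_layerSubgroup hK jbar κ (hd1 j hj) (C.layer_le (j + 1)) (hnot j hj)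
  have hd01 : ∀ j, C.depth < j → C.d j ≤ C.d (j + 1) - 1 := fun j hj ↦
    not_lt.mp fun h ↦ C.d_min j _ h (hpredle j hj.le)
  have hshift : ∀ j, C.depth < j → C.d (j + 1) = C.d j + (C.d (j + 1) - 1 - C.d j) + 1 := by
    intro j hj
    have h01 := hd01 j hj
    have h1 := hd1 j hj.le
    omega
  have hv1 : ∀ j, C.depth < j →
      C.v (j + 1) = A (C.d (j + 1) - 1 - C.d j) • C.u j + B (C.d (j + 1) - 1 - C.d j) • C.v j := by
    intro j hj
    have h := sum_transversal_smul_pred_eq_lucas_of_layer_succ hK hH Dt hβ jbar hpN hx hP hfix κ A B hA0 hA1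
      hArec hB0 hB1 hBrec (k := j) (d₁ := C.d (j + 1)) (d₀ := C.d j) (hd1 j hj.le) (C.layer_le (j + 1))
      (hnot j hj.le) (hA (j + 1)).1 (hA (j + 1)).2 (hd0 j hj) (hd01 j hj) (C.layer_le j)
      (hA j).1 (hA j).2
    rw [hv (j + 1), hu j, hv j]
    exact h
  have hvfix : ∀ j, C.depth ≤ j → ∀ σ ∈ κ.layerSubgroup j, σ • C.v (j + 1) = C.v (j + 1) := by
    intro j hj σ hσ
    rw [hv (j + 1)]
    exact smul_sum_transversal_smul_pred_eq_of_layer_succ hK jbar hfix κ (hd1 j hj) (C.layer_le (j + 1))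
      (hnot j hj) (hA (j + 1)).1 (hA (j + 1)).2 hσ
  have hnorm : ∀ j, C.depth < j →
      ∑ i ∈ Finset.range p, (γ ^ (p ^ j * i)) • C.u (j + 1) =
        A (C.d (j + 1) - 1 - C.d j + 1) • C.u j + B (C.d (j + 1) - 1 - C.d j + 1) • C.v j := by
    intro j hj
    have h := sum_range_pow_smul_sum_transversal_smul_eq_lucas hK hH Dt hβ jbar hpN hx hP hfix κ A B hA0 hA1
      hArec hB0 hB1 hBrec hγ (k := j) (d₁ := C.d (j + 1)) (d₀ := C.d j) (hd1 j hj.le) (C.layer_le (j + 1))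
      (hA (j + 1)).1 (hA (j + 1)).2 (hd0 j hj) (hd01 j hj) (C.layer_le j) (hA j).1 (hA j).2
    have heq : C.d (j + 1) - C.d j = C.d (j + 1) - 1 - C.d j + 1 := by
      have h01 := hd01 j hj
      have h1 := hd1 j hj.le
      omega
    rw [hu (j + 1), hu j, hv j, ← heq]
    exact h
  have hz' : ∀ j, C.depth < j → ∃ a b : ℤ, ¬ (p : ℤ) ∣ a ∧ F.z j = a • C.u j + b • C.v j :=
    fun j hj ↦ HeegnerFamily.exists_z_eq_zsmul_u_add_zsmul_v_of_presentation F C hK hH Dt hβ hpN hap hTw1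
      hcardp hxP hA hu hv hR hz hj
  -- the `Λ`-adic stabilised class with exact projections, and the cyclicity
  obtain ⟨z, hzcl⟩ := exists_proj_mem_stabilizedClassLayer_of_coherent D C hord hγ A B hA0 hA1 hArec hB0 hB1
    hBrec (fun j ↦ C.d (j + 1) - 1 - C.d j) hv1 (fun j hj ↦ hvfix j hj.le) hnorm hshift
  have hcyc : stabilizedHeegnerModule D C = Submodule.span (IwasawaAlgebra p) {z} :=
    stabilizedHeegnerModule_eq_span_singleton D C hE fun k hk ↦
      ⟨1, isUnit_one, D.proj k z, hzcl k hk, (padicPi_one (W.baseChange K) p (κ.layerSubgroup k) _).symm⟩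
  -- growth of the shift: `d(δ + 1 + m) ≥ m + 2`
  have hgrow : ∀ m, m + 2 ≤ C.d (C.depth + 1 + m) := by
    intro m
    induction m with
    | zero => simpa using htwo (C.depth + 1) (by omega)
    | succ m ih =>
      have h := hd01 (C.depth + 1 + m) (by omega)
      rw [show C.depth + 1 + (m + 1) = C.depth + 1 + m + 1 by omega]
      omega
  -- THE NON-VANISHING `z ≠ 0` from Cornut–Vatsal
  have hz_ne : z ≠ 0 := by
    intro hz0
    obtain ⟨n₀, hn₀⟩ := CornutVatsal2007.thm110_trivialCharacter hCV hK hH hpN κ hκ Dt hβ jbar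
    -- the working layer `j + 1`, `j = δ + 1 + n₀ > δ`, conductor exponent `d₁ = d(j+1) ≥ n₀`
    set j : ℕ := C.depth + 1 + n₀ with hj
    have hjδ : C.depth < j := by omega
    have hjδ' : C.depth ≤ j := hjδ.le
    have hjk : C.depth < j + 1 := by omega
    set d₁ : ℕ := C.d (j + 1) with hd₁
    have hd₁n₀ : n₀ ≤ d₁ := by
      have h := hgrow (n₀ + 1)
      rw [show C.depth + 1 + (n₀ + 1) = j + 1 by omega] at h
      omega
    set H := κ.layerSubgroup (j + 1) with hHdef
    set τ : Field.absoluteGaloisGroup K := γ ^ p ^ j with hτ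
    have hτj : τ ∈ κ.layerSubgroup j := by
      have h := κ.topGenerator_pow_mem_layerSubgroup hγ j 1
      rwa [mul_one] at h
    -- Kummer families of `u = u_{j+1}`, `v = v_{j+1}` over `H`
    have hufix : ∀ σ ∈ H, σ • C.u (j + 1) = C.u (j + 1) := fun σ hσ ↦ C.smul_u_eq hjk hσ
    have hvfixH : ∀ σ ∈ H, σ • C.v (j + 1) = C.v (j + 1) := fun σ hσ ↦ C.smul_v_eq hjk hσ
    obtain ⟨du, hdu⟩ := (W.baseChange K).exists_isKummerFamilyOver p H (C.u (j + 1)) hufix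
    obtain ⟨dv, hdv⟩ := (W.baseChange K).exists_isKummerFamilyOver p H (C.v (j + 1)) hvfixH
    -- `z = 0` ⇒ the stabilised class `α^{-d₁}(du − α⁻¹ dv)` vanishes ⇒ `du = α⁻¹ · dv`
    have hXmem := padicPi_kummerDiff_mem_stabilizedClassLayer C (j + 1) hjk hdu hdv
    have h0mem : (0 : (W.baseChange K).torsionH1Pi p H) ∈ stabilizedClassLayer C (j + 1) hjk := by
      have h := hzcl (j + 1) hjk
      rwa [hz0, map_zero] at h
    have hX0 := stabilizedClassLayer_eq_of_mem C (j + 1) hjk hXmem h0mem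
    have hdiff0 : du - (W.baseChange K).padicPi p H (Ring.inverse (unitRoot W p)) dv = 0 := by
      have h := congrArg ((W.baseChange K).padicPi p H (unitRoot W p ^ d₁)) hX0
      rwa [padicPi_padicPi, unitRoot_pow_mul_ringInverse_pow W p hord, padicPi_one, map_zero] at h
    have hduv : du = (W.baseChange K).padicPi p H (Ring.inverse (unitRoot W p)) dv := sub_eq_zero.mp hdiff0
    -- `τ u − u` is torsion
    have htor : IsOfFinAddOrder (τ • C.u (j + 1) - C.u (j + 1)) :=
      isOfFinAddOrder_smul_sub_of_isKummerFamilyOver_eq_padicPi (W.baseChange K) κ (j + 1) τ hufix hvfixH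
        (hvfix j hjδ' τ hτj) hdu hdv hduv
    -- Cornut–Vatsal at the Heegner point `x_{d₁}` with the product transversal `{γ^i}_{i<p^{j+1}} · A_{j+1}`
    set S : Finset (Field.absoluteGaloisGroup K) := (Finset.range (p ^ (j + 1))).image fun i : ℕ ↦ γ ^ i with hSdef
    have htS := κ.existsUnique_topGenerator_pow_of_lt hγ (j + 1)
    have hinj := injOn_mul_of_transversal (Mid := H) (S := S) (A := Aₜ (j + 1)) htS (hA (j + 1)).1
    have htR := existsUnique_mul_of_transversal (Mid := H) (H := ringClassSubgroup K (p ^ d₁) jbar)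
      (S := S) (A := Aₜ (j + 1)) (C.layer_le (j + 1)) htS (hA (j + 1)).1 (hA (j + 1)).2
    obtain ⟨φ, ⟨k', hk'⟩, hφR, ⟨σ', hσ'R, hσ'ne⟩, hsum⟩ :=
      hn₀ d₁ hd₁n₀ (x d₁) _ (hgeom d₁) (hfix d₁) htR
    -- `φ` kills `H = Gal(K̄/K_{j+1})` (`K_{j+1} ⊆ K[p^{d₁}]`, `K_{j+2} ⊄ K[p^{d₁}]`)
    have hd₁lt : d₁ < C.d (j + 1 + 1) := by
      have h01 := hd01 (j + 1) hjk
      have h2 := hd1 (j + 1) hjk.le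
      omega
    have hφH : ∀ σ ∈ H, φ σ = 1 :=
      κ.apply_eq_one_of_le_layerSubgroup_of_not_le φ hk' hφR (C.layer_le (j + 1)) (C.d_min (j + 1 + 1) d₁ hd₁lt)
    -- `φ(τ) ≠ 1` (`σ' ∈ Gal(K̄/K[p^{d₁-1}]) ≤ Gal(K̄/K_j)`), `φ(γ^{p^{j+1}}) = 1`, `γ^{p^{j+1}} u = u`
    have hφτ : φ τ ≠ 1 := κ.apply_topGenerator_pow_ne_one φ hγ hφH (hpredle j hjδ' hσ'R) hσ'ne
    have hφper : φ (γ ^ p ^ (j + 1)) = 1 := κ.apply_topGenerator_pow_eq_one φ hγ hφH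
    have huper : γ ^ p ^ (j + 1) • C.u (j + 1) = C.u (j + 1) := by
      refine hufix _ ?_
      have h := κ.topGenerator_pow_mem_layerSubgroup hγ (j + 1) 1
      rwa [mul_one] at h
    -- the character sum over the product transversal is `Σ_{i<p^{j+1}} φ(γ^i) ⊗ γ^i u`, which vanishes
    have hφA : ∀ a ∈ Aₜ (j + 1), φ a = 1 := fun a ha ↦ hφH a ((hA (j + 1)).1 a ha)
    have hsum' : CornutVatsal2007.heegnerCharSum φ ((S ×ˢ Aₜ (j + 1)).image fun q ↦ q.1 * q.2) (x d₁) =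
        ∑ i ∈ Finset.range (p ^ (j + 1)), ((φ (γ ^ i) : ℂˣ) : ℂ) ⊗ₜ[ℤ] (γ ^ i • C.u (j + 1)) := by
      rw [heegnerCharSum_image_mul_eq φ hinj hφA, ← hu (j + 1), hSdef,
        Finset.sum_image (κ.topGenerator_pow_injOn_range hγ (j + 1))]
    exact hsum (hsum'.trans
      (sum_range_tmul_smul_eq_zero_of_isOfFinAddOrder φ γ (C.u (j + 1)) huper hφper htor hφτ))
  -- assemble
  refine ⟨C, F, hCDt, hFDt, hCβ, hFβ, ?_, ?_, z, hzcl, hcyc, hz_ne⟩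
  · exact heegnerModule_le_stabilizedHeegnerModule_of_coherent D F C hord hγ hE A B hA0 hA1 hArec hB0 hB1 hBrec
      (fun j ↦ C.d (j + 1) - 1 - C.d j) hv1 (fun j hj ↦ hvfix j hj.le) hnorm (fun j hj ↦ by
        obtain ⟨a, b, -, h⟩ := hz' j hj
        exact ⟨a, b, h⟩)
  · exact exists_ne_zero_smul_stabilizedHeegnerModule_le_heegnerModule_of_coherent D F C hγ hz'
      (fun j hj ↦ ⟨_, _, hv1 j hj⟩) (hvfix C.depth le_rfl)

/-- **The coherent pair of the L∃ letter with `Λκ_∞(C) ≠ ⊥`, granted Cornut–Vatsal 2007 Thm. 1.10**: under the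
engine's hypotheses (+ `κ` anticyclotomic), `∃ C F` on `(Dt, β)` with `ℋ_∞(F) ≤ Λκ_∞(C)`, `g • Λκ_∞(C) ≤ ℋ_∞(F)`
(`g ≠ 0`) and `stabilizedHeegnerModule D C ≠ ⊥` — the Cornut–Vatsal conjunct of the binder
`PrintX9.CGLSHeegnerClassNonvanishing` AT THE ENGINE'S DATUM, from the primitive leaf.
[cite: CornutVatsal2007, Thm. 1.10] [cite: CastellaGrossiLeeSkinner2022, Rem. 4.1.4 (κ₁^{Hg} ≠ 0)] -/
theorem exists_coherent_pair_envelope_ne_bot_of_thm110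
    (hCV : CornutVatsal2007.thm110_exists_heegnerCharSum_ne_zero) (hK : IsImaginaryQuadratic K)
    (hH : SatisfiesHeegnerHypothesis (W.conductorNorm ℤ) K) (Dt : ModularParametrizationData W (W.conductorNorm ℤ))
    {β : ℤ} (hβ : (4 * (W.conductorNorm ℤ : ℕ) : ℤ) ∣ β ^ 2 - NumberField.discr K)
    (jbar : AlgebraicClosure K →+* ℂ) (hord : IsOrdinaryAt W p) (hpN : ¬ p ∣ W.conductorNorm ℤ)
    (κ : ZpExtension K p) (hκ : κ.IsAnticyclotomic) {γ : Field.absoluteGaloisGroup K} (hγ : κ.IsTopGenerator γ)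
    (hTw1 : ∀ k, ringClassSubgroup K (p ^ (k + 1)) jbar ≤ κ.layerSubgroup k)
    (hcardp : Nat.card (ringClassGalOver (jbar.comp (algebraMap K (AlgebraicClosure K))) p 1) = p - 1)
    (hE : ∀ Q : (W.baseChange K).toAffine.Point, p • Q = 0 → Q = 0)
    (D : (W.baseChange K).LambdaAdicSelmerData κ γ) :
    ∃ (C : StabilizedHeegnerData (W.conductorNorm ℤ) W K κ jbar) (F : HeegnerFamily (W.conductorNorm ℤ) W K κ jbar),
      C.Dt = Dt ∧ F.Dt = Dt ∧ C.β = β ∧ F.β = β ∧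
      heegnerModule D F ≤ stabilizedHeegnerModule D C ∧
      (∃ g : IwasawaAlgebra p, g ≠ 0 ∧ g • stabilizedHeegnerModule D C ≤ heegnerModule D F) ∧
      stabilizedHeegnerModule D C ≠ ⊥ := by
  obtain ⟨C, F, hCDt, hFDt, hCβ, hFβ, hfwd, hrev, z, -, hcyc, hz⟩ :=
    exists_coherent_pair_envelope_class_ne_zero_of_thm110 hCV hK hH Dt hβ jbar hord hpN κ hκ hγ hTw1 hcardp hE D
  refine ⟨C, F, hCDt, hFDt, hCβ, hFβ, hfwd, hrev, ?_⟩
  rw [hcyc, Ne, Submodule.span_singleton_eq_bot]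
  exact hz

end Envelope

end Literature.NumberTheory.EllipticCurves

end
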